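import Mathlib
import Summits.Ventures.PercRepro2.Defs
import Summits.Ventures.PercRepro2.Graph
import Summits.Ventures.PercRepro2.Events
import Summits.Ventures.PercRepro2.CycleDefs
import Summits.Ventures.PercRepro2.CycleTerm
import Summits.Ventures.PercRepro2.CycleDecode
import Summits.Ventures.PercRepro2.AntipodalKleitman
import Summits.Ventures.PercRepro2.CycleBase
import Summits.Ventures.PercRepro2.CycleHit
import Summits.Ventures.PercRepro2.CycleCoreA

/-!
# Every antipodal base case of a cycle with a hit set is nonnegative (blind cell PercRepro2, mine-a g47)

The antipodal base cases of (T_A) on a cycle — `Q = {A ⊆ C_0}` — with a set `F` of edges pinned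
closed in both copies:

  `wtFA τ = 1[A ⊆ arc (τ ∪ F)] · (1[arc (τ ∪ F) ∈ 𝓤] − 1[arc ((D∖τ) ∪ F) ∈ 𝓤]) · (same for 𝓥)`.

**Theorem `sum_wtFA_nonneg`**: `Σ_{τ ⊆ D} wtFA τ ≥ 0` for up-sets `𝓤 𝓥`.  Cases: no pinned-closed
edge and some vertex of `A` strictly inside the hull of `D` — the counting core
`CycleCoreA.sum_wtA_nonneg` at that witness; no pinned-closed edge and every vertex of `A` outside
the hull — every arc contains `A`, the antipodal Harris form (`AntipodalKleitman` with
`G = G' = ∅`); pinned-closed edges on both sides of some vertex of `A` — no arc contains `A`, the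
sum is `0`; otherwise every vertex of `A` sees `F` on one side, the hit weight forces the red
edges into the block `D₀` of positions compatible with all of `A`, and the sum is the comparable
antipodal form over `D₀` with the rest of `D` pinned closed in the second copy.  No instance,
no notation.
-/

namespace Summit.Ventures.PercRepro2

namespace TCycle

open Finset

variable {n : ℕ}

open Classical in
/-- The term with the hit set `A` and the edges of `F` closed in both copies. -/
noncomputable def wtFA (D F A : Finset (Fin (n + 1))) (𝓤 𝓥 : Set (Set (Fin (n + 1))))
    (τ : Finset (Fin (n + 1))) : ℤ :=
  (if hitA A (arc (τ ∪ F)) then 1 else 0)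
    * ((if arc (τ ∪ F) ∈ 𝓤 then 1 else 0) - (if arc ((D \ τ) ∪ F) ∈ 𝓤 then 1 else 0))
    * ((if arc (τ ∪ F) ∈ 𝓥 then 1 else 0) - (if arc ((D \ τ) ∪ F) ∈ 𝓥 then 1 else 0))

/-- Without pinned-closed edges the term is `wtA`. -/
lemma wtFA_empty (D A : Finset (Fin (n + 1))) (𝓤 𝓥 : Set (Set (Fin (n + 1))))
    (τ : Finset (Fin (n + 1))) : wtFA D ∅ A 𝓤 𝓥 τ = wtA D A 𝓤 𝓥 τ := by
  unfold wtFA wtA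
  have h1 : τ ∪ ∅ = τ := Finset.union_empty τ
  have h2 : D \ τ ∪ ∅ = D \ τ := Finset.union_empty _
  rw [h1, h2]

/-- The term when the hit predicate holds, through `arcInd`. -/
lemma wtFA_of_hit {D F A : Finset (Fin (n + 1))} {𝓤 𝓥 : Set (Set (Fin (n + 1)))}
    {τ : Finset (Fin (n + 1))} (hh : hitA A (arc (τ ∪ F))) :
    wtFA D F A 𝓤 𝓥 τ = (arcInd 𝓤 (τ ∪ F) - arcInd 𝓤 ((D \ τ) ∪ F))
      * (arcInd 𝓥 (τ ∪ F) - arcInd 𝓥 ((D \ τ) ∪ F)) := by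
  unfold wtFA arcInd
  simp [hh]

/-- The term when the hit predicate fails is `0`. -/
lemma wtFA_of_not_hit {D F A : Finset (Fin (n + 1))} {𝓤 𝓥 : Set (Set (Fin (n + 1)))}
    {τ : Finset (Fin (n + 1))} (hh : ¬ hitA A (arc (τ ∪ F))) : wtFA D F A 𝓤 𝓥 τ = 0 := by
  unfold wtFA
  simp [hh]

section Cases

variable {D F A : Finset (Fin (n + 1))} {𝓤 𝓥 : Set (Set (Fin (n + 1)))}

/-- **No pinned-closed edge, `A` inside the arc of `D`**: every arc contains `A` and the sum is the
antipodal Harris form. -/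
lemma sum_wtFA_nonneg_of_hit (hU : IsUpperSet 𝓤) (hV : IsUpperSet 𝓥) (hh : hitA A (arc D)) :
    0 ≤ ∑ τ ∈ D.powerset, wtFA D ∅ A 𝓤 𝓥 τ := by
  have hsum : ∀ τ ∈ D.powerset, wtFA D ∅ A 𝓤 𝓥 τ =
      (arcInd 𝓤 (τ ∪ ∅) - arcInd 𝓤 ((D \ τ) ∪ ∅)) *
        (arcInd 𝓥 (τ ∪ ∅) - arcInd 𝓥 ((D \ τ) ∪ ∅)) := by
    intro τ hτ
    rw [mem_powerset] at hτ
    exact wtFA_of_hit (by rw [Finset.union_empty]; exact hitA_mono (arc_anti hτ) hh)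
  rw [sum_congr rfl hsum]
  exact AntipodalKleitman.antipodal_comparable_nonneg D ∅ ∅ (arcInd 𝓤) (arcInd 𝓥) (le_refl _)
    (arcInd_zero_one 𝓤) (arcInd_antitone hU) (arcInd_zero_one 𝓥) (arcInd_antitone hV)

/-- **No pinned-closed edge**: the base case is nonnegative. -/
lemma sum_wtFA_nonneg_empty (hU : IsUpperSet 𝓤) (hV : IsUpperSet 𝓥) :
    0 ≤ ∑ τ ∈ D.powerset, wtFA D ∅ A 𝓤 𝓥 τ := by
  by_cases hD : D.Nonempty
  · by_cases hc : ∃ c ∈ A, D.min' hD < c ∧ c ≤ D.max' hD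
    · obtain ⟨c, hcA, hc0, hc1⟩ := hc
      rw [sum_congr rfl fun τ _ => wtFA_empty D A 𝓤 𝓥 τ]
      exact sum_wtA_nonneg hD hU hV hcA hc0 hc1
    · apply sum_wtFA_nonneg_of_hit hU hV
      intro a ha
      rw [arc_eq_min_max hD]
      by_cases h1 : D.min' hD < a
      · exact Or.inr (lt_of_not_ge fun h2 => hc ⟨a, ha, h1, h2⟩)
      · exact Or.inl (not_lt.1 h1)
  · rw [not_nonempty_iff_eq_empty] at hD
    subst hD
    apply sum_wtFA_nonneg_of_hit hU hV
    rw [arc_empty]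
    exact hitA_univ A

/-- **Pinned-closed edges on both sides of a vertex of `A`**: no arc contains `A`, the sum vanishes. -/
lemma sum_wtFA_eq_zero_of_straddle {a : Fin (n + 1)} (ha : a ∈ A) (hx : ∃ x ∈ F, x < a)
    (hy : ∃ y ∈ F, a ≤ y) : ∑ τ ∈ D.powerset, wtFA D F A 𝓤 𝓥 τ = 0 := by
  refine sum_eq_zero fun τ _ => wtFA_of_not_hit fun hh => ?_
  obtain ⟨x, hxF, hxa⟩ := hx
  obtain ⟨y, hyF, hya⟩ := hy
  rcases hh a ha with hc | hc
  · exact absurd (hc x (mem_union_right _ hxF)) (not_le.2 hxa)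
  · exact absurd (hc y (mem_union_right _ hyF)) (not_lt.2 hya)

/-- The block of positions compatible with every vertex of `A` relative to `F`: below every `a`
that lies above `F`, and at or above every `a` that lies at or below `F`. -/
def block (D F A : Finset (Fin (n + 1))) : Finset (Fin (n + 1)) :=
  D.filter fun i => ∀ a ∈ A, ((∀ x ∈ F, x < a) → i < a) ∧ ((∀ x ∈ F, a ≤ x) → a ≤ i)

/-- The block lies in `D`. -/
lemma block_subset (D F A : Finset (Fin (n + 1))) : block D F A ⊆ D := filter_subset _ _

/-- When `F` is nonempty and no vertex of `A` is straddled by `F`, the hit predicate on `τ ∪ F`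
(for `τ ⊆ D`) says exactly that `τ` lies in the block. -/
lemma hitA_iff_subset_block (hF : F.Nonempty)
    (hns : ∀ a ∈ A, (∀ x ∈ F, x < a) ∨ (∀ x ∈ F, a ≤ x)) {τ : Finset (Fin (n + 1))}
    (hτ : τ ⊆ D) : hitA A (arc (τ ∪ F)) ↔ τ ⊆ block D F A := by
  obtain ⟨x₀, hx₀⟩ := hF
  constructor
  · intro hh i hi
    refine mem_filter.2 ⟨hτ hi, fun a ha => ⟨fun hlow => ?_, fun hhigh => ?_⟩⟩
    · rcases hh a ha with hc | hc
      · exact absurd (hc x₀ (mem_union_right _ hx₀)) (not_le.2 (hlow x₀ hx₀))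
      · exact hc i (mem_union_left _ hi)
    · rcases hh a ha with hc | hc
      · exact hc i (mem_union_left _ hi)
      · exact absurd (hc x₀ (mem_union_right _ hx₀)) (not_lt.2 (hhigh x₀ hx₀))
  · intro hsub a ha
    rcases hns a ha with hlow | hhigh
    · refine Or.inr fun i hi => ?_
      rcases mem_union.1 hi with hi | hi
      · exact ((mem_filter.1 (hsub hi)).2 a ha).1 hlow
      · exact hlow i hi
    · refine Or.inl fun i hi => ?_
      rcases mem_union.1 hi with hi | hi
      · exact ((mem_filter.1 (hsub hi)).2 a ha).2 hhigh
      · exact hhigh i hi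

/-- The subsets of `D` contained in the block are the subsets of the block. -/
lemma powerset_filter_subset_block :
    D.powerset.filter (fun τ => τ ⊆ block D F A) = (block D F A).powerset := by
  ext τ
  simp only [mem_filter, mem_powerset]
  constructor
  · rintro ⟨_, h2⟩; exact h2
  · intro h1; exact ⟨le_trans h1 (block_subset D F A), h1⟩

/-- For `τ` in the block, `D ∖ τ = (block ∖ τ) ∪ (D ∖ block)`. -/
lemma sdiff_eq_of_subset_block {τ : Finset (Fin (n + 1))} (hτ : τ ⊆ block D F A) :
    D \ τ = (block D F A \ τ) ∪ (D \ block D F A) := by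
  ext x
  simp only [mem_sdiff, mem_union]
  constructor
  · rintro ⟨hxD, hxτ⟩
    by_cases hxb : x ∈ block D F A
    · exact Or.inl ⟨hxb, hxτ⟩
    · exact Or.inr ⟨hxD, hxb⟩
  · rintro (⟨hxb, hxτ⟩ | ⟨hxD, hxb⟩)
    · exact ⟨block_subset D F A hxb, hxτ⟩
    · exact ⟨hxD, fun hxτ => hxb (hτ hxτ)⟩

/-- **Pinned-closed edges, no vertex of `A` straddled**: the sum is the comparable antipodal form
over the block. -/
lemma sum_wtFA_nonneg_of_block (hU : IsUpperSet 𝓤) (hV : IsUpperSet 𝓥) (hF : F.Nonempty)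
    (hns : ∀ a ∈ A, (∀ x ∈ F, x < a) ∨ (∀ x ∈ F, a ≤ x)) :
    0 ≤ ∑ τ ∈ D.powerset, wtFA D F A 𝓤 𝓥 τ := by
  have hsum : ∑ τ ∈ D.powerset, wtFA D F A 𝓤 𝓥 τ =
      ∑ τ ∈ (block D F A).powerset,
        (arcInd 𝓤 (τ ∪ F) - arcInd 𝓤 ((block D F A \ τ) ∪ ((D \ block D F A) ∪ F))) *
          (arcInd 𝓥 (τ ∪ F) - arcInd 𝓥 ((block D F A \ τ) ∪ ((D \ block D F A) ∪ F))) := by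
    rw [← powerset_filter_subset_block, sum_filter]
    refine sum_congr rfl fun τ hτ => ?_
    have hτD : τ ⊆ D := mem_powerset.1 hτ
    by_cases hsub : τ ⊆ block D F A
    · rw [if_pos hsub, wtFA_of_hit ((hitA_iff_subset_block hF hns hτD).2 hsub),
        sdiff_eq_of_subset_block hsub, union_assoc]
    · rw [if_neg hsub, wtFA_of_not_hit fun hc => hsub ((hitA_iff_subset_block hF hns hτD).1 hc)]
  rw [hsum]
  exact AntipodalKleitman.antipodal_comparable_nonneg (block D F A) F ((D \ block D F A) ∪ F)
    (arcInd 𝓤) (arcInd 𝓥) subset_union_right (arcInd_zero_one 𝓤) (arcInd_antitone hU)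
    (arcInd_zero_one 𝓥) (arcInd_antitone hV)

/-- **Every antipodal base case of a cycle with a hit set is nonnegative.** -/
theorem sum_wtFA_nonneg (hU : IsUpperSet 𝓤) (hV : IsUpperSet 𝓥) :
    0 ≤ ∑ τ ∈ D.powerset, wtFA D F A 𝓤 𝓥 τ := by
  by_cases hF : F.Nonempty
  · by_cases hns : ∀ a ∈ A, (∀ x ∈ F, x < a) ∨ (∀ x ∈ F, a ≤ x)
    · exact sum_wtFA_nonneg_of_block hU hV hF hns
    · push Not at hns
      obtain ⟨a, ha, hx, hy⟩ := hns
      rw [sum_wtFA_eq_zero_of_straddle ha hy hx]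
  · rw [not_nonempty_iff_eq_empty] at hF
    subst hF
    exact sum_wtFA_nonneg_empty hU hV

end Cases

end TCycle

end Summit.Ventures.PercRepro2
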